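import Literature.NumberTheory.EllipticCurves.LeadingTerm
import Literature.NumberTheory.EllipticCurves.PAdicHeights
import HarnessLib

/-!
# Skinner–Zhang 2014 (arXiv:1407.1099, UNREFEREED): Heegner-point indivisibility and the `p`-part of BSD at a prime `p ‖ N`

HONEST FRAMING (cell `b2b-bsdres`, BSD rank-≤1 residual classes): the goal is to DELETE the
COMBINATION-SHAPED residual classes for ALL analytic-rank `≤ 1` curves over `ℚ` strictly from
PUBLISHED theorems; construction-shaped classes are TYPED (missing-input `Prop`s), not attempted;
an ANNOUNCED preprint enters only as an explicitly labelled OPEN hypothesis. This is not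
"finishing BSD".

Source: C. Skinner, W. Zhang, *Indivisibility of Heegner points in the multiplicative case*,
arXiv:1407.1099v1 (4 July 2014), §1, Theorems 1.1–1.3 [SkinnerZhang2014]. **STATUS: PREPRINT
since 2014, never published** (arXiv lists v1 only; no journal version as of August 2026 — checked
against the arXiv listing recorded in `papers/BirchSwinnertonDyer/bsd-percentage/FRESHNESS.md`,
rows "1407.1099 v1"). Under the cell's rules the statements below are therefore NOT theorems of the
tree's literature floor: they are named `Prop`s carrying the tag `[claim: …, status: under-review]`
and the suffix `_OPEN`, to be taken as explicitly labelled open hypotheses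
`(hSZ : SkinnerZhang2014.thm1_2_padicVal_bsd_rankOne_OPEN)`; a class theorem using one is
CONDITIONAL (referee protocol R0/A5 of the cell, `run/shared/lean/b2b/bsd-rank1-residual/REFEREE.md`).

This file transcribes, word for word,

* Theorem 1.2 (the `p`-part of the Birch–Swinnerton-Dyer formula in analytic rank one at a prime
  `p ≥ 5` of multiplicative reduction, under hypotheses (a)–(e) of Theorem 1.1):
  `thm1_2_padicVal_bsd_rankOne_OPEN`;
* and records (`Hypotheses.exists_ramified_ne`) that hypothesis (e) forces a second multiplicative
  prime `ℓ ≠ p` at which `E[p]` is ramified. Deliberately NOT here: Theorem 1.1 (the `p`-converse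
  under (a)–(f), (f) = "`Sel_{p^∞}(E/ℚ)` has `ℤ_p`-corank one"; the tree's Selmer corank lives in
  `BSDSelmer`, a heavier import, and the residual-class cell needs Thm. 1.2 only) and Theorem 1.3
  (Kolyvagin's non-vanishing `κ ≠ {0}` mod `p` under Hypothesis ♠), whose objects (mod-`p` Kolyvagin
  systems on Shimura curves) the tree spells in `HeegnerPointsKolyvaginStructure`.

Printed text (arXiv:1407.1099v1, §1, p. 1–2), Theorem 1.1: "Let `E/ℚ` be an elliptic curve with
conductor `N` and minimal discriminant `Δ` and let `p ≥ 5` be a prime. Suppose (a) `E` has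
multiplicative reduction at `p` (equivalently, `p ∣∣ N`); (b) `p ∤ ord_p(Δ)`, and if `E` has split
multiplicative reduction at `p` then `log_p q_E ∈ pℤ_p^×`, where `q_E ∈ ℚ_p^×` is the Tate period of
`E/ℚ_p`; (c) `E[p]` is an irreducible `Gal(ℚ̄/ℚ)`-module; (d) for all primes `ℓ ∣∣ N` such that
`ℓ ≡ ±1 (mod p)`, `p ∤ ord_ℓ(Δ)`; (e) there exist at least two prime factors `ℓ ∣∣ N` such that
`p ∤ ord_ℓ(Δ)`; (f) the `p^∞`-Selmer group `Sel_{p^∞}(E/ℚ)` has `ℤ_p`-corank one. Then the rank and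
analytic rank of `E/ℚ` are both equal to `1` and the Tate-Shafarevich group `Ш(E/ℚ)` is finite."
Theorem 1.2: "Let `E/ℚ` be an elliptic curve and let `p ≥ 5` be a prime. Suppose hypotheses
(a)-(e) of Theorem 1.1 hold and that `ord_{s=1} L(E,s) = 1`. Then
`ord_p(L'(E,1)/(Ω_E · Reg(E/ℚ))) = ord_p(#Ш(E/ℚ) · ∏_{ℓ∣N} c_ℓ)`. Here
`Reg(E/ℚ) = ⟨y,y⟩_{NT}/[E(ℚ):ℤy]²` with `y ∈ E(ℚ)` any non-torsion point and `⟨y,y⟩_{NT}` the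
canonical Néron–Tate height of `y`, `Ω_E` is the canonical (Néron) period of `E`, and the `c_ℓ` are
the local Tamagawa numbers of `E` at the primes `ℓ`." The authors add: "The first condition in (b)
… is equivalent to `E[p]` not being finite as a representation of `Gal(ℚ̄_p/ℚ_p)`, and … the second
condition in (b) is then equivalent to the Mazur–Tate–Teitelbaum `𝔏`-invariant of `E` belonging
to `pℤ_p^×`. The indivisibility condition in (d) and (e) is equivalent to `E[p]` being ramified at
the prime `ℓ`."

## Transcription (tree vocabulary; conventions of bsd.S30 `padicValRat_bsd_rank_zero`)

* `E` = a globally minimal Weierstrass equation `W` over `ℚ` (`[W.IsElliptic] [W.IsGloballyMinimal]`),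
  so that `W.realPeriodRat` is the Néron period `Ω_E` (it includes the number of real components;
  `p` is odd, so a factor `2` is invisible to `ord_p`) and `W.minimalDiscriminantInt` is `Δ`.
* "`ℓ ∣∣ N`" = `W.HasMultiplicativeReductionAtPrime ℓ` (for an elliptic curve over `ℚ` the exponent
  of `ℓ` in the conductor is `1` iff the reduction is multiplicative; Silverman ATAEC IV.10.2, tree
  `conductorExponent_eq_one_iff`); "`p ∤ ord_ℓ(Δ)`" = `¬ p ∣ padicValInt ℓ W.minimalDiscriminantInt`
  exactly as in bsd.S30's auxiliary-prime binder `haux`.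
* (b): split multiplicative reduction = `W.HasSplitMultiplicativeReductionAtPrime p`; the Tate
  period is the field `q` of any `D : WeierstrassCurve.TateParameterData W p` (such data exist iff
  the reduction is split multiplicative, and `q` is unique: named facts
  `nonempty_tateParameterData_iff`, `TateParameterData.q_unique` of `PAdicHeights`), `log_p` is the
  Iwasawa logarithm `padicLog p`, and "`log_p q_E ∈ pℤ_p^×`" is "`ord_p(log_p q_E) = 1`"
  (`Padic.valuation`, whose junk value `v(0) = 0 ≠ 1` correctly excludes `log_p q_E = 0`).
* (d): "`ℓ ≡ ±1 (mod p)`" = `(ℓ : ZMod p) = 1 ∨ (ℓ : ZMod p) = -1`.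
* Conclusion: `L'(E,1) = W.leadingLCoeff` when `ord_{s=1} L(E,s) = 1` (`W.leadingLCoeff` is
  `L^{(r)}(E,1)/r!`, `r = W.analyticRank`); `Reg(E/ℚ) = W.regulator` (Gram determinant of the
  Néron–Tate pairing on a basis of `E(ℚ)/tors`, `ĥ` Clay-normalised — for rank one this is
  `ĥ(y)/[E(ℚ):ℤy]²` for any non-torsion `y`; a normalisation of `ĥ` by a power of `2` is invisible
  to `ord_p`, `p ≥ 5`); `#Ш(E/ℚ) = W.shaOrder`, a genuine order under the binder `Finite W.sha`
  (which for `ord_{s=1} L(E,s) = 1` is the theorem of Gross–Zagier–Kolyvagin, tree fact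
  `rank_eq_analyticRank_of_analyticRank_le_one`, bsd.S17 — kept as a binder as in bsd.S30);
  `∏_{ℓ∣N} c_ℓ = W.tamagawaProduct` (`c_ℓ = 1` at good `ℓ`). The printed formula has no torsion term:
  `E(ℚ)[p] = 0` under (c) (tree theorem `not_exists_addOrderOf_eq_of_hasIrreducibleModPGaloisRep`).
  The rationality of `L'(E,1)/(Ω_E · Reg)` is part of the transcription (`∃ q : ℚ`), as in bsd.S30;
  in print it is the Gross–Zagier formula.

What the hypotheses EXCLUDE (used by the residual-class census, class X11 of
`papers/BirchSwinnertonDyer/bsd-percentage/RESIDUAL-CASES.md` §a.2): by (e) together with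
Hypothesis ♠ (3) ("`Ram(ρ̄_{E,p}) ≠ ∅`", where `Ram` collects the primes `ℓ ∣∣ N`, `ℓ ≠ p`, at which
`ρ̄` is ramified) every curve covered has a SECOND multiplicative prime `ℓ ≠ p` with `E[p]`
ramified at `ℓ` — the census predicate `ram(p)`; so Theorem 1.2 never reaches the sub-class
`mult(p) ∧ irr(p) ∧ ¬ram(p)` (e.g. `N = p`). It does allow `N` non-square-free (additive primes
elsewhere), which Castella, Camb. J. Math. 6 (2018), Thm. A as printed does not.
-/

noncomputable section

open scoped Classical

open WeierstrassCurve

namespace Literature.NumberTheory.EllipticCurves.SkinnerZhang2014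

/-- Hypotheses (a)–(e) of Skinner–Zhang, arXiv:1407.1099v1, Thm. 1.1, for a globally minimal
`W/ℚ` and a prime `p` (the bound `p ≥ 5` is kept outside): (a) multiplicative reduction at `p`;
(b) `p ∤ ord_p(Δ)`, and in the split multiplicative case `log_p q_E ∈ pℤ_p^×` for the Tate period
`q_E` (every Tate parameter datum `D`, whose `D.q` is `q_E`); (c) `E[p]` irreducible; (d) for every
prime `ℓ` of multiplicative reduction with `ℓ ≡ ±1 (mod p)`, `p ∤ ord_ℓ(Δ)`; (e) there are two
distinct primes `ℓ₁, ℓ₂` of multiplicative reduction with `p ∤ ord_{ℓ_i}(Δ)` (`ℓ_i = p` allowed, as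
printed). A predicate (no claim); transcription conventions in the module docstring.
[cite: SkinnerZhang2014, Thm. 1.1, hypotheses (a)–(e) (arXiv:1407.1099v1 p. 1)] -/
structure Hypotheses (W : WeierstrassCurve ℚ) [W.IsElliptic] [W.IsGloballyMinimal] (p : ℕ)
    [Fact p.Prime] : Prop where
  /-- (a) `E` has multiplicative reduction at `p` (`p ∣∣ N`). -/
  mult : W.HasMultiplicativeReductionAtPrime p
  /-- (b), first clause: `p ∤ ord_p(Δ)` (`E[p]` is not finite at `p`). -/
  not_dvd_ord_disc : ¬ p ∣ padicValInt p W.minimalDiscriminantInt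
  /-- (b), second clause: if the reduction at `p` is split, `log_p q_E ∈ p ℤ_p^×`, i.e.
  `ord_p (log_p q_E) = 1`, for the Tate period `q_E = D.q`. -/
  log_tatePeriod : W.HasSplitMultiplicativeReductionAtPrime p →
    ∀ D : TateParameterData W p, (padicLog p D.q).valuation = 1
  /-- (c) `E[p]` is an irreducible `Gal(ℚ̄/ℚ)`-module. -/
  irr : W.HasIrreducibleModPGaloisRep p
  /-- (d) for all primes `ℓ ∣∣ N` with `ℓ ≡ ±1 (mod p)`, `p ∤ ord_ℓ(Δ)`. -/
  ram_of_congr : ∀ (ℓ : ℕ) (_ : Fact ℓ.Prime), W.HasMultiplicativeReductionAtPrime ℓ →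
    ((ℓ : ZMod p) = 1 ∨ (ℓ : ZMod p) = -1) → ¬ p ∣ padicValInt ℓ W.minimalDiscriminantInt
  /-- (e) at least two prime factors `ℓ ∣∣ N` with `p ∤ ord_ℓ(Δ)`. -/
  two_ramified : ∃ (ℓ₁ ℓ₂ : ℕ) (_ : Fact ℓ₁.Prime) (_ : Fact ℓ₂.Prime), ℓ₁ ≠ ℓ₂ ∧
    W.HasMultiplicativeReductionAtPrime ℓ₁ ∧ W.HasMultiplicativeReductionAtPrime ℓ₂ ∧
    ¬ p ∣ padicValInt ℓ₁ W.minimalDiscriminantInt ∧ ¬ p ∣ padicValInt ℓ₂ W.minimalDiscriminantInt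

/-- **OPEN HYPOTHESIS — UNREFEREED PREPRINT (arXiv:1407.1099v1, 2014; no journal version as of
August 2026).** Skinner–Zhang, *Indivisibility of Heegner points in the multiplicative case*,
Thm. 1.2 (§1, p. 2): "Let `E/ℚ` be an elliptic curve and let `p ≥ 5` be a prime. Suppose
hypotheses (a)-(e) of Theorem 1.1 hold and that `ord_{s=1} L(E,s) = 1`. Then
`ord_p(L'(E,1)/(Ω_E · Reg(E/ℚ))) = ord_p(#Ш(E/ℚ) · ∏_{ℓ∣N} c_ℓ)`", with (a)–(e) as in `Hypotheses`
(printed wording in its docstring and the module docstring), `Ω_E` "the canonical (Néron) period",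
`Reg(E/ℚ) = ⟨y,y⟩_{NT}/[E(ℚ):ℤy]²`, `c_ℓ` the local Tamagawa numbers. Transcribed in the shape of
bsd.S30 (`padicValRat_bsd_rank_zero`): for globally minimal `W` with `W.analyticRank = 1` and
finite `Ш` (the latter is Gross–Zagier–Kolyvagin, bsd.S17, kept as a binder), the number
`L'(E,1)/(Ω_E · Reg) = W.leadingLCoeff/(W.realPeriodRat · W.regulator)` is a rational `q` with
`ord_p q = ord_p #Ш + ord_p ∏ c_ℓ` (no torsion term: `E(ℚ)[p] = 0` by (c)). The printed proof rests
on Thm. 1.3 (Kolyvagin's non-vanishing statement mod `p` at `p ∣∣ N`), the Gross–Zagier formula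
on Shimura curves (Yuan–Zhang–Zhang) and, on the rank-`0` side, Skinner's cyclotomic IMC at
multiplicative `p` (Pacific J. Math. 283 (2016), Thm. C). NEVER cite this `Prop` as a theorem: take it as
an explicit hypothesis; a result using it is conditional on an unrefereed claim.
[claim: SkinnerZhang2014, status: under-review] -/
def thm1_2_padicVal_bsd_rankOne_OPEN : Prop :=
  ∀ (W : WeierstrassCurve ℚ) [W.IsElliptic] [W.IsGloballyMinimal] (p : ℕ) [Fact p.Prime],
    5 ≤ p → Hypotheses W p → W.analyticRank = 1 → Finite W.sha →
    ∃ q : ℚ, W.leadingLCoeff / ((W.realPeriodRat * W.regulator : ℝ) : ℂ) = (q : ℂ) ∧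
      padicValRat p q = (padicValNat p W.shaOrder : ℤ) + padicValNat p W.tamagawaProduct

/-- Hypothesis (e) supplies a multiplicative prime `ℓ ≠ p` with `p ∤ ord_ℓ(Δ)` — the census
predicate `ram(p)` ("there is `q ∣∣ N`, `q ≠ p`, with `E[p]` ramified at `q`", transcribed as in
bsd.S30): of two distinct primes at most one equals `p`. Hence Skinner–Zhang's Thm. 1.2 never
applies to a pair `(E, p)` without a second ramified multiplicative prime (residual class X11,
first disjunct). [cite: SkinnerZhang2014, Thm. 1.1 (e) (arXiv:1407.1099v1 p. 1)] -/
theorem Hypotheses.exists_ramified_ne {W : WeierstrassCurve ℚ} [W.IsElliptic] [W.IsGloballyMinimal]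
    {p : ℕ} [Fact p.Prime] (h : Hypotheses W p) :
    ∃ (ℓ : ℕ) (_ : Fact ℓ.Prime), ℓ ≠ p ∧ W.HasMultiplicativeReductionAtPrime ℓ ∧
      ¬ p ∣ padicValInt ℓ W.minimalDiscriminantInt := by
  obtain ⟨ℓ₁, ℓ₂, i₁, i₂, hne, hm₁, hm₂, hr₁, hr₂⟩ := h.two_ramified
  by_cases h₁ : ℓ₁ = p
  · refine ⟨ℓ₂, i₂, ?_, hm₂, hr₂⟩
    rintro rfl
    exact hne h₁
  · exact ⟨ℓ₁, i₁, h₁, hm₁, hr₁⟩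

end Literature.NumberTheory.EllipticCurves.SkinnerZhang2014

end
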